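import Mathlib
import HarnessLib
import Literature.NumberTheory.LFunctions.ZetaScrew
import Literature.NumberTheory.LFunctions.WeilExplicit

/-!
# Route `IntegerScrew` — the SCREW ↔ WEIL dictionary, part 1: bumps and configuration test functions

Analytic preliminaries for `IntegerScrewWeilWindowPSD` (PIVOT-LAW §16): the smooth downward step
`Θ_ε(x) = 1 − σ(x/ε)` built on Mathlib's `Real.smoothTransition σ`, its derivative bump
`ρ(x/ε)/ε` (`ρ = σ'`: continuous, non-negative, supported in `[0,1]`, mass `1`), the approximate
identity `∫ k(u) ρ((u−p)/ε)/ε du → k(p)` in quantitative form, joint continuity of Suzuki's kernel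
`G(t,u) = Ψ(t) + Ψ(u) − Ψ(t−u)` (`zetaScrewKernel`) and continuity of its bump averages, and the
Weil TEST FUNCTION of a zero-sum configuration `(sᵢ, wᵢ)`, `g_ε = ∑ wᵢ Θ_ε(· − sᵢ)`: smooth,
compactly supported in `[min sᵢ, max sᵢ + ε]` (because `∑ wᵢ = 0`), with
`g_ε' = −∑ wᵢ ρ((· − sᵢ)/ε)/ε`.  Elementary real analysis; nothing here bears on the truth of RH.

References: M. Suzuki, J. Lond. Math. Soc. (2) 108 (2023) = arXiv:2206.03682, §3.3 [Suzuki2023].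
-/

noncomputable section

-- D-0017: `Summit.<S>.<S>.…` is the designed namespace of a single-problem summit.
set_option linter.dupNamespace false

namespace Summit.RiemannHypothesis.RiemannHypothesis.Theorems.IntegerScrew

open Literature.NumberTheory.LFunctions MeasureTheory Set Filter Finset
open scoped Topology ComplexConjugate ContDiff


/-! ## The smooth step and its derivative bump -/

/-- `ρ(x) ≠ 0 ⟹ 0 ≤ x ≤ 1` for `ρ = σ'`, `σ = smoothTransition` (`σ` is constant off `[0,1]`).
[folklore] -/
theorem mem_Icc_of_deriv_smoothTransition_ne_zero {x : ℝ} (hx : deriv Real.smoothTransition x ≠ 0) :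
    0 ≤ x ∧ x ≤ 1 := by
  constructor
  · by_contra h
    apply hx
    have he : Real.smoothTransition =ᶠ[𝓝 x] fun _ => (0 : ℝ) := by
      filter_upwards [Iio_mem_nhds (lt_of_not_ge h)] with y hy
      exact Real.smoothTransition.zero_of_nonpos (le_of_lt hy)
    rw [he.deriv_eq, deriv_const]
  · by_contra h
    apply hx
    have he : Real.smoothTransition =ᶠ[𝓝 x] fun _ => (1 : ℝ) := by
      filter_upwards [Ioi_mem_nhds (lt_of_not_ge h)] with y hy
      exact Real.smoothTransition.one_of_one_le (le_of_lt hy)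
    rw [he.deriv_eq, deriv_const]

/-- The rescaled bump `ρ((u − c)/ε)/ε` is non-negative (`σ` is monotone). [folklore] -/
theorem bump_nonneg {ε : ℝ} (hε : 0 < ε) (c u : ℝ) :
    0 ≤ deriv Real.smoothTransition ((u - c) / ε) / ε := by
  refine div_nonneg ?_ hε.le
  have hd : HasDerivAt Real.smoothTransition (deriv Real.smoothTransition ((u - c) / ε))
      ((u - c) / ε) :=
    ((Real.smoothTransition.contDiff (n := 1)).differentiable one_ne_zero _).hasDerivAt
  rw [hasDerivAt_iff_tendsto_slope] at hd
  refine ge_of_tendsto hd ?_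
  filter_upwards [self_mem_nhdsWithin] with y hy
  rcases lt_or_gt_of_ne hy with h | h
  · rw [slope_def_field]
    exact div_nonneg_of_nonpos (sub_nonpos.2 (Real.smoothTransition.monotone h.le))
      (sub_nonpos.2 h.le)
  · rw [slope_def_field]
    exact div_nonneg (sub_nonneg.2 (Real.smoothTransition.monotone h.le)) (sub_nonneg.2 h.le)

/-- The rescaled bump is continuous (`σ` is `C¹`). [folklore] -/
theorem continuous_bump (ε c : ℝ) :
    Continuous fun u : ℝ => deriv Real.smoothTransition ((u - c) / ε) / ε :=
  (((Real.smoothTransition.contDiff (n := 1)).continuous_deriv le_rfl).comp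
    ((continuous_id.sub continuous_const).div_const ε)).div_const ε

/-- `∫ ρ = 1` (the step rises from `0` to `1`). [folklore] -/
theorem integral_deriv_smoothTransition : ∫ x : ℝ, deriv Real.smoothTransition x = 1 := by
  have hcont : Continuous (deriv Real.smoothTransition) :=
    (Real.smoothTransition.contDiff (n := 1)).continuous_deriv le_rfl
  have hneg : ∀ y : ℝ, y < 0 → deriv Real.smoothTransition y = 0 := by
    intro y hy
    by_contra h
    exact absurd (mem_Icc_of_deriv_smoothTransition_ne_zero h).1 (not_le.2 hy)
  have hsupp : Function.support (deriv Real.smoothTransition) ⊆ Ioc (0 : ℝ) 1 := by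
    intro x hx
    have h := mem_Icc_of_deriv_smoothTransition_ne_zero hx
    refine ⟨lt_of_le_of_ne h.1 ?_, h.2⟩
    intro h0
    apply hx
    rw [← h0]
    -- `ρ(0) = 0` by continuity from the left
    have hc := hcont.continuousAt (x := (0 : ℝ))
    have h1 : Tendsto (deriv Real.smoothTransition) (𝓝[<] (0 : ℝ)) (𝓝 0) := by
      apply tendsto_const_nhds.congr'
      filter_upwards [self_mem_nhdsWithin] with y hy
      exact (hneg y hy).symm
    exact tendsto_nhds_unique (hc.tendsto.mono_left nhdsWithin_le_nhds) h1
  rw [← intervalIntegral.integral_eq_integral_of_support_subset hsupp,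
    intervalIntegral.integral_deriv_eq_sub (fun x _ =>
      (Real.smoothTransition.contDiff (n := 1)).differentiable one_ne_zero x)
      (hcont.intervalIntegrable _ _),
    Real.smoothTransition.one, Real.smoothTransition.zero, sub_zero]

/-- The rescaled bump `ρ((u − c)/ε)/ε` has integral `1` (`ε > 0`). [folklore] -/
theorem integral_bump_eq_one {ε : ℝ} (hε : 0 < ε) (c : ℝ) :
    ∫ u : ℝ, deriv Real.smoothTransition ((u - c) / ε) / ε = 1 := by
  have h1 : (∫ u : ℝ, deriv Real.smoothTransition ((u - c) / ε) / ε)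
      = (∫ u : ℝ, deriv Real.smoothTransition ((u - c) / ε)) / ε := by
    rw [← integral_div]
  rw [h1]
  have h2 : (∫ u : ℝ, deriv Real.smoothTransition ((u - c) / ε))
      = ∫ u : ℝ, (fun v => deriv Real.smoothTransition (v / ε)) (u - c) := rfl
  rw [h2, integral_sub_right_eq_self (fun v => deriv Real.smoothTransition (v / ε)) c,
    Measure.integral_comp_div (fun v => deriv Real.smoothTransition v) ε,
    integral_deriv_smoothTransition, abs_of_pos hε, smul_eq_mul, mul_one, div_self hε.ne']

/-- The rescaled bump is supported in `[c, c + ε]`. [folklore] -/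
theorem mem_Icc_of_bump_ne_zero {ε : ℝ} (hε : 0 < ε) {c u : ℝ}
    (h : deriv Real.smoothTransition ((u - c) / ε) / ε ≠ 0) : c ≤ u ∧ u ≤ c + ε := by
  have h' : deriv Real.smoothTransition ((u - c) / ε) ≠ 0 := by
    intro h0; exact h (by rw [h0, zero_div])
  have hI := mem_Icc_of_deriv_smoothTransition_ne_zero h'
  constructor
  · have := hI.1; rw [le_div_iff₀ hε] at this; linarith
  · have := hI.2; rw [div_le_iff₀ hε] at this; linarith


/-- The rescaled bump has compact support. [folklore] -/
theorem hasCompactSupport_bump {ε : ℝ} (hε : 0 < ε) (c : ℝ) :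
    HasCompactSupport fun u : ℝ => deriv Real.smoothTransition ((u - c) / ε) / ε := by
  refine HasCompactSupport.intro (isCompact_Icc (a := c) (b := c + ε)) fun u hu => ?_
  by_contra h
  exact hu (Set.mem_Icc.2 (mem_Icc_of_bump_ne_zero hε h))

/-- **Approximate identity.** If a continuous `k` is within `δ` of `c` on `[p, p + ε]`, then its
average against the bump `ρ((· − p)/ε)/ε` is within `δ` of `c`. [folklore] -/
theorem abs_integral_mul_bump_sub_le {k : ℝ → ℝ} (hk : Continuous k) {ε : ℝ} (hε : 0 < ε)
    (p c δ : ℝ) (hδ : ∀ u, p ≤ u → u ≤ p + ε → |k u - c| ≤ δ) :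
    |(∫ u : ℝ, k u * (deriv Real.smoothTransition ((u - p) / ε) / ε)) - c| ≤ δ := by
  set ρ : ℝ → ℝ := fun u => deriv Real.smoothTransition ((u - p) / ε) / ε with hρ
  have hρc : Continuous ρ := continuous_bump ε p
  have hρs : HasCompactSupport ρ := hasCompactSupport_bump hε p
  have hρi : Integrable ρ := hρc.integrable_of_hasCompactSupport hρs
  have hkρi : Integrable fun u => k u * ρ u :=
    (hk.mul hρc).integrable_of_hasCompactSupport hρs.mul_left
  have hρ1 : (∫ u : ℝ, ρ u) = 1 := integral_bump_eq_one hε p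
  have h1 : (∫ u : ℝ, k u * ρ u) - c = ∫ u : ℝ, (k u - c) * ρ u := by
    have hc : c = ∫ u : ℝ, c * ρ u := by
      rw [integral_const_mul, hρ1, mul_one]
    rw [hc, ← integral_sub hkρi (hρi.const_mul c)]
    refine integral_congr_ae (Filter.Eventually.of_forall fun u => ?_)
    simp only
    rw [← hc]
    ring
  rw [h1]
  have hbound : ∀ u, ‖(k u - c) * ρ u‖ ≤ δ * ρ u := by
    intro u
    rw [Real.norm_eq_abs, abs_mul, abs_of_nonneg (bump_nonneg hε p u)]
    by_cases hu : ρ u = 0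
    · have hu' : deriv Real.smoothTransition ((u - p) / ε) / ε = 0 := hu
      simp [hu, hu']
    · have hI := mem_Icc_of_bump_ne_zero hε hu
      exact mul_le_mul_of_nonneg_right (hδ u hI.1 hI.2) (bump_nonneg hε p u)
  calc |∫ u : ℝ, (k u - c) * ρ u| = ‖∫ u : ℝ, (k u - c) * ρ u‖ := (Real.norm_eq_abs _).symm
    _ ≤ ∫ u : ℝ, δ * ρ u := norm_integral_le_of_norm_le (hρi.const_mul δ)
        (Filter.Eventually.of_forall hbound)
    _ = δ := by rw [integral_const_mul, hρ1, mul_one]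

/-- The kernel `G(t,u) = Ψ(t) + Ψ(u) − Ψ(t − u)` is jointly continuous. [folklore] -/
theorem continuous_zetaScrewKernel_uncurry :
    Continuous (Function.uncurry zetaScrewKernel) := by
  have h : Function.uncurry zetaScrewKernel =
      fun p : ℝ × ℝ => zetaScrew p.1 + zetaScrew p.2 - zetaScrew (p.1 - p.2) := by
    funext p
    rfl
  rw [h]
  exact ((continuous_zetaScrew.comp continuous_fst).add
    (continuous_zetaScrew.comp continuous_snd)).sub
    (continuous_zetaScrew.comp (continuous_fst.sub continuous_snd))

/-- The kernel is continuous in its second variable. [folklore] -/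
theorem continuous_zetaScrewKernel_right (t : ℝ) : Continuous fun u : ℝ => zetaScrewKernel t u := by
  have h : (fun u : ℝ => zetaScrewKernel t u) =
      fun u => zetaScrew t + zetaScrew u - zetaScrew (t - u) := by
    funext u
    exact zetaScrewKernel_def t u
  rw [h]
  exact (continuous_const.add continuous_zetaScrew).sub
    (continuous_zetaScrew.comp (continuous_const.sub continuous_id))

/-- The bump average `φ(t) = ∫ G(t,u) ρ((u − c)/ε)/ε du` of the kernel is continuous in `t`
(a parametric integral of a continuous integrand over the compact `[c, c + ε]`). [folklore] -/
theorem continuous_integral_zetaScrewKernel_mul_bump {ε : ℝ} (hε : 0 < ε) (c : ℝ) :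
    Continuous fun t : ℝ =>
      ∫ u : ℝ, zetaScrewKernel t u * (deriv Real.smoothTransition ((u - c) / ε) / ε) := by
  have h : (fun t : ℝ =>
        ∫ u : ℝ, zetaScrewKernel t u * (deriv Real.smoothTransition ((u - c) / ε) / ε)) =
      fun t : ℝ => ∫ u in Set.Icc c (c + ε),
        zetaScrewKernel t u * (deriv Real.smoothTransition ((u - c) / ε) / ε) := by
    funext t
    refine (setIntegral_eq_integral_of_forall_compl_eq_zero fun u hu => ?_).symm
    have : deriv Real.smoothTransition ((u - c) / ε) / ε = 0 := by
      by_contra h0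
      exact hu (Set.mem_Icc.2 (mem_Icc_of_bump_ne_zero hε h0))
    rw [this, mul_zero]
  rw [h]
  exact continuous_parametric_integral_of_continuous
    (f := fun t u : ℝ => zetaScrewKernel t u * (deriv Real.smoothTransition ((u - c) / ε) / ε))
    (continuous_zetaScrewKernel_uncurry.mul ((continuous_bump ε c).comp continuous_snd))
    isCompact_Icc

/-! ## The test function of a zero-sum configuration -/

/-- Derivative of `g_ε(u) = ∑ wᵢ (1 − σ((u − sᵢ)/ε))` (`σ = smoothTransition`):
`g_ε'(u) = ∑ wᵢ · (−ρ((u − sᵢ)/ε)/ε)`. [folklore] -/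
theorem hasDerivAt_configTest {m : ℕ} (s w : Fin m → ℝ) (ε u : ℝ) :
    HasDerivAt
      (fun u : ℝ => ((∑ i, w i * (1 - Real.smoothTransition ((u - s i) / ε)) : ℝ) : ℂ))
      (((∑ i, w i * (-(deriv Real.smoothTransition ((u - s i) / ε) / ε)) : ℝ) : ℂ)) u := by
  apply HasDerivAt.ofReal_comp
  have key : ∀ i, HasDerivAt (fun u : ℝ => w i * (1 - Real.smoothTransition ((u - s i) / ε)))
      (w i * (-(deriv Real.smoothTransition ((u - s i) / ε) / ε))) u := by
    intro i
    have h1 : HasDerivAt (fun u : ℝ => (u - s i) / ε) (1 / ε) u := by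
      simpa using ((hasDerivAt_id u).sub_const (s i)).div_const ε
    have h2 : HasDerivAt Real.smoothTransition
        (deriv Real.smoothTransition ((u - s i) / ε)) ((u - s i) / ε) :=
      ((Real.smoothTransition.contDiff (n := 1)).differentiable one_ne_zero _).hasDerivAt
    have h3 : HasDerivAt (fun u : ℝ => Real.smoothTransition ((u - s i) / ε))
        (deriv Real.smoothTransition ((u - s i) / ε) * (1 / ε)) u := by
      have h := h2.comp u h1
      simpa only [Function.comp_def] using h
    have h4 := (h3.const_sub (1 : ℝ)).const_mul (w i)
    have h5 : w i * (-(deriv Real.smoothTransition ((u - s i) / ε) / ε))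
        = w i * (-(deriv Real.smoothTransition ((u - s i) / ε) * (1 / ε))) := by ring
    rw [h5]
    exact h4
  exact HasDerivAt.fun_sum fun i _ => key i

/-- `g_ε` is smooth. [folklore] -/
theorem contDiff_configTest {m : ℕ} (s w : Fin m → ℝ) (ε : ℝ) :
    ContDiff ℝ ∞
      (fun u : ℝ => ((∑ i, w i * (1 - Real.smoothTransition ((u - s i) / ε)) : ℝ) : ℂ)) := by
  have h : ContDiff ℝ ∞ (fun u : ℝ => ∑ i, w i * (1 - Real.smoothTransition ((u - s i) / ε))) := by
    refine ContDiff.sum fun i _ => ?_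
    refine (contDiff_const (c := w i)).mul ((contDiff_const (c := (1 : ℝ))).sub ?_)
    exact Real.smoothTransition.contDiff.comp
      ((contDiff_id.sub (contDiff_const (c := s i))).div_const ε)
  exact (Complex.ofRealCLM.contDiff : ContDiff ℝ ∞ (fun x : ℝ => (x : ℂ))).comp h

/-- Left of all steps the zero-sum test function vanishes: `g_ε(u) = ∑ wᵢ = 0` for `u ≤ min sᵢ`.
[folklore] -/
theorem configTest_eq_zero_of_le {m : ℕ} (s w : Fin m → ℝ) {ε : ℝ} (hε : 0 < ε)
    (hw : ∑ i, w i = 0) {u : ℝ} (hu : ∀ i, u ≤ s i) :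
    (((∑ i, w i * (1 - Real.smoothTransition ((u - s i) / ε)) : ℝ) : ℂ)) = 0 := by
  have h : ∀ i, w i * (1 - Real.smoothTransition ((u - s i) / ε)) = w i := by
    intro i
    rw [Real.smoothTransition.zero_of_nonpos
      (div_nonpos_of_nonpos_of_nonneg (by linarith [hu i]) hε.le)]
    ring
  simp_rw [h, hw]
  simp

/-- Right of all steps it vanishes: `g_ε(u) = 0` for `u ≥ max sᵢ + ε`. [folklore] -/
theorem configTest_eq_zero_of_ge {m : ℕ} (s w : Fin m → ℝ) {ε : ℝ} (hε : 0 < ε)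
    {u : ℝ} (hu : ∀ i, s i + ε ≤ u) :
    (((∑ i, w i * (1 - Real.smoothTransition ((u - s i) / ε)) : ℝ) : ℂ)) = 0 := by
  have h : ∀ i, w i * (1 - Real.smoothTransition ((u - s i) / ε)) = 0 := by
    intro i
    rw [Real.smoothTransition.one_of_one_le ((one_le_div hε).2 (by linarith [hu i]))]
    ring
  simp_rw [h]
  simp

/-- `g_ε` is a Weil test function supported in `[b⁻, b⁺ + ε]` whenever `b⁻ ≤ sᵢ ≤ b⁺` and
`∑ wᵢ = 0`. [folklore] -/
theorem isWeilTest_configTest {m : ℕ} (s w : Fin m → ℝ) {ε : ℝ} (hε : 0 < ε)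
    (hw : ∑ i, w i = 0) {bl bu : ℝ} (hb : ∀ i, bl ≤ s i ∧ s i ≤ bu) :
    IsWeilTest (fun u : ℝ => ((∑ i, w i * (1 - Real.smoothTransition ((u - s i) / ε)) : ℝ) : ℂ)) ∧
      tsupport (fun u : ℝ => ((∑ i, w i * (1 - Real.smoothTransition ((u - s i) / ε)) : ℝ) : ℂ))
        ⊆ Set.Icc bl (bu + ε) := by
  have hzero : ∀ u, u ∉ Set.Icc bl (bu + ε) →
      (((∑ i, w i * (1 - Real.smoothTransition ((u - s i) / ε)) : ℝ) : ℂ)) = 0 := by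
    intro u hu
    rw [Set.mem_Icc, not_and_or, not_le, not_le] at hu
    rcases hu with hu | hu
    · exact configTest_eq_zero_of_le s w hε hw fun i => by linarith [(hb i).1]
    · exact configTest_eq_zero_of_ge s w hε fun i => by linarith [(hb i).2]
  have hK : HasCompactSupport
      (fun u : ℝ => ((∑ i, w i * (1 - Real.smoothTransition ((u - s i) / ε)) : ℝ) : ℂ)) :=
    HasCompactSupport.intro isCompact_Icc hzero
  refine ⟨⟨contDiff_configTest s w ε, hK⟩, ?_⟩
  refine closure_minimal (fun u hu => ?_) isClosed_Icc
  by_contra h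
  exact hu (hzero u h)

end Summit.RiemannHypothesis.RiemannHypothesis.Theorems.IntegerScrew
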